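import Summits.CriticalPhenomena.PercolationContinuityZ3.Theorems.Transplant.CommutingPairOneEnd
import Summits.CriticalPhenomena.PercolationContinuityZ3.Theorems.Transplant.GrigorchukTimesZResidueScope
import HarnessLib

/-!
# Both certified witnesses of the residue node, `Cay(𝔊; a,b,c,d)` (indeed every `Cay(𝔊; S)`) and `Cay(𝔊 × ℤ; a,b,c,d,z)`, have EXACTLY ONE END —
# consistency instances of Benjamini–Schramm's Question 3 / Lyons–Peres Conj. 7.27 (hypothesis AND conclusion kernel; the questions stay OPEN)

builds on p205010 (kernel theorem, internal audit signed; external expert review pending) — nothing in this file uses p205010; no node touched, nothing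
about `θ(p_c)`.  Lane `prim-bschramm`, seat `prim-bschramm-gen-1` gen 10 (GEN pen; offer O-OE file F-OE2, lead g27 GO 2026-08-28T16:29Z #8552, refuter math
note p5-g32 #8551).  Helper file (`--supports stmt-CriticalPhenomena-4575 --as helper`).  Def-free (proof lane); no instance, no notation.
Inputs: «GrigorchukRigidStabilizers» p606245 (the commuting pair `ristG 0`, `ristG 1`: commute, meet trivially, infinite, finitely generated; `B = ⟨b⟩^𝔊` of
finite index with `B ≤ range φᵢ|_{ristG i}`), «GrigorchukSectionsDefs» p590401 (`ψ = (φ₀, φ₁)` injective on `St(1)`), «GrigorchukLevelTransitive» p593398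
(`[𝔊 : St_𝔊(1)] = 2`), F-OE1 «CommutingPairOneEnd» (`OneEnd.end_existsUnique_of_commuting_subgroups`).
* §1 `exists_ristG_coset_reps`: `ristG 0 · ristG 1` is CO-BOUNDED in `𝔊` — `ψ⁻¹(B × B) ≤ St_𝔊(1)` has finite index (Mathlib `index_comap`) and lies in the
  product, so finitely many right representatives `F` give `g f = a b` for every `g`.
* §2 **`Cay(𝔊; S)` has EXACTLY ONE END for EVERY finite generating `S`** (`cayley_gens_existsUnique_end`, `stdCay_existsUnique_end`); customers: the
  CONSISTENCY INSTANCES `stdCay_question3_instance` / `cayley_gens_conj_7_27_instance` — connected, (quasi-)transitive, ONE END, and `p_u < 1` (kernel since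
  p613200, amenability) all hold: an instance of «StatementTransitiveGraphConjectures» `BenjaminiSchramm1996_question3` / `LyonsPeres2016_conj_7_27`, NOT
  evidence about them (their content is non-amenable); they stay OPEN.
* §3 **`Cay(𝔊 × ℤ; a,b,c,d,z)` has EXACTLY ONE END** (`gzCay_existsUnique_end`: the pair `𝔊 × 1 = ⟨a,b,c,d⟩`, `1 × ℤ = ⟨z⟩`, `F = {1}`); `p_u = p_c < 1` there
  (`gzCay_uniquenessProb_lt_one`, amenability p645243 + Lyons–Peres 7.6) and the same consistency instance.
NOT CLAIMED: anything for `Γ₂ = ℤ ≀_X 𝔊` (one-ended in print via Stallings — not typed); any node; `θ(p_c)`.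
[cite: BenjaminiSchramm1996, Def. 1 (p. 75), Question 3 (p. 79), §2] [cite: LyonsPeres2016, §7.6 Conj. 7.27, Thm. 7.6] [cite: MuchnikPak2001, Lemma 2 and Cor. 1]
[cite: BartholdiErschler2012, §3.1 (St(1), ψ injective, B × B ≤ ψ(St(1)))]
-/

noncomputable section

namespace Summit.CriticalPhenomena.PercolationContinuityZ3.Theorems.Transplant

namespace Grigorchuk

open SimpleGraph Literature.Barriers.CriticalPhenomena Literature.Probability.Percolation Literature.Probability.LatticeModels
open scoped Classical

/-! ## §1 `ristG 0 · ristG 1` is co-bounded in `𝔊` (finite index of `ψ⁻¹(B × B)`) -/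

/-- **Right coset representatives for `ristG 0 · ristG 1`**: a finite `F ⊆ 𝔊` with `∀ g, ∃ f ∈ F, g·f ∈ ristG 0 · ristG 1`.  (`ψ⁻¹(B × B) ≤ St_𝔊(1)` has
finite index and lies in the product; `[𝔊 : St_𝔊(1)] = 2`.) [cite: MuchnikPak2001, Lemma 2 and Cor. 1] [cite: BartholdiErschler2012, §3.1] -/
theorem exists_ristG_coset_reps : ∃ F : Finset ↥grigorchukGroup, ∀ g : ↥grigorchukGroup,
    ∃ f ∈ F, ∃ a ∈ ristG false, ∃ b ∈ ristG true, g * f = a * b := by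
  -- `St_𝔊(1)` inside `Γ`, and `ψ = (φ₀, φ₁) : St_𝔊(1) →* Γ × Γ`
  let St : Subgroup ↥grigorchukGroup := stabOne.comap grigorchukGroup.subtype
  let toSt : ↥St → ↥stabOne := fun h => ⟨((h : ↥grigorchukGroup) : Equiv.Perm Ray), h.2⟩
  have toSt_mul : ∀ h k : ↥St, toSt (h * k) = toSt h * toSt k := fun _ _ => rfl
  let ψ : ↥St →* ↥grigorchukGroup × ↥grigorchukGroup :=
    { toFun := fun h => (⟨sec false (toSt h), sec_mem_grigorchukGroup (toSt h) (h : ↥grigorchukGroup).2 false⟩,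
        ⟨sec true (toSt h), sec_mem_grigorchukGroup (toSt h) (h : ↥grigorchukGroup).2 true⟩)
      map_one' := Prod.ext (Subtype.ext (by change sec false (toSt 1) = 1; exact map_one (sec false)))
        (Subtype.ext (by change sec true (toSt 1) = 1; exact map_one (sec true)))
      map_mul' := fun h k => Prod.ext
        (Subtype.ext (by change sec false (toSt (h * k)) = sec false (toSt h) * sec false (toSt k); rw [toSt_mul, map_mul]))
        (Subtype.ext (by change sec true (toSt (h * k)) = sec true (toSt h) * sec true (toSt k); rw [toSt_mul, map_mul])) }
  have ψ_fst : ∀ h : ↥St, (((ψ h).1 : ↥grigorchukGroup) : Equiv.Perm Ray) = sec false (toSt h) := fun _ => rfl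
  have ψ_snd : ∀ h : ↥St, (((ψ h).2 : ↥grigorchukGroup) : Equiv.Perm Ray) = sec true (toSt h) := fun _ => rfl
  -- `K₁ = ψ⁻¹(B × B)` has finite index in `St_𝔊(1)`
  let K₁ : Subgroup ↥St := (normalClosureB.prod normalClosureB).comap ψ
  haveI := normalClosureB_finiteIndex
  haveI hK₁ : K₁.FiniteIndex := ⟨by
    change ((normalClosureB.prod normalClosureB).comap ψ).index ≠ 0
    rw [Subgroup.index_comap]
    change ((normalClosureB.prod normalClosureB).subgroupOf ψ.range).index ≠ 0
    exact Subgroup.FiniteIndex.index_ne_zero⟩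
  -- representatives of `St_𝔊(1) ⧸ K₁`
  let R : Finset ↥St := (Set.finite_range fun q : ↥St ⧸ K₁ => q.out).toFinset
  have hR : ∀ h : ↥St, ∃ x ∈ R, h * x ∈ K₁ := fun h => by
    obtain ⟨k, hk⟩ := QuotientGroup.mk_out_eq_mul K₁ h⁻¹
    refine ⟨(QuotientGroup.mk h⁻¹ : ↥St ⧸ K₁).out, by simp only [R, Set.Finite.mem_toFinset, Set.mem_range_self], ?_⟩
    rw [hk, mul_inv_cancel_left]
    exact k.2
  -- `K₁ ⊆ ristG 0 · ristG 1`
  have hAB : ∀ h : ↥St, h ∈ K₁ → ∃ a ∈ ristG false, ∃ b ∈ ristG true, (h : ↥grigorchukGroup) = a * b := by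
    intro h hh
    have hh' : (ψ h).1 ∈ normalClosureB ∧ (ψ h).2 ∈ normalClosureB := by
      have := Subgroup.mem_comap.1 hh
      exact Subgroup.mem_prod.1 this
    obtain ⟨a, ha⟩ := normalClosureB_le_range_secR false hh'.1
    obtain ⟨b, hb⟩ := normalClosureB_le_range_secR true hh'.2
    refine ⟨a, a.2, b, b.2, ?_⟩
    have ha' : sec false ⟨((a : ↥grigorchukGroup) : Equiv.Perm Ray), rist_le_stabOne false a.2⟩ = sec false (toSt h) := by
      rw [← coe_secR, ha, ψ_fst]
    have hb' : sec true ⟨((b : ↥grigorchukGroup) : Equiv.Perm Ray), rist_le_stabOne true b.2⟩ = sec true (toSt h) := by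
      rw [← coe_secR, hb, ψ_snd]
    have hb0 : sec false ⟨((b : ↥grigorchukGroup) : Equiv.Perm Ray), rist_le_stabOne true b.2⟩ = 1 :=
      sec_not_eq_one (i := true) b.2
    have ha1 : sec true ⟨((a : ↥grigorchukGroup) : Equiv.Perm Ray), rist_le_stabOne false a.2⟩ = 1 :=
      sec_not_eq_one (i := false) a.2
    have hprod : (⟨((a : ↥grigorchukGroup) : Equiv.Perm Ray) * ((b : ↥grigorchukGroup) : Equiv.Perm Ray),
        stabOne.mul_mem (rist_le_stabOne false a.2) (rist_le_stabOne true b.2)⟩ : ↥stabOne) =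
        ⟨((a : ↥grigorchukGroup) : Equiv.Perm Ray), rist_le_stabOne false a.2⟩ *
          ⟨((b : ↥grigorchukGroup) : Equiv.Perm Ray), rist_le_stabOne true b.2⟩ := rfl
    have key : toSt h = ⟨((a : ↥grigorchukGroup) : Equiv.Perm Ray) * ((b : ↥grigorchukGroup) : Equiv.Perm Ray),
        stabOne.mul_mem (rist_le_stabOne false a.2) (rist_le_stabOne true b.2)⟩ :=
      eq_of_sec_eq (by rw [hprod, map_mul, ha', hb0, mul_one]) (by rw [hprod, map_mul, hb', ha1, one_mul])
    have e2 : ((h : ↥grigorchukGroup) : Equiv.Perm Ray) =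
        ((a : ↥grigorchukGroup) : Equiv.Perm Ray) * ((b : ↥grigorchukGroup) : Equiv.Perm Ray) := congrArg Subtype.val key
    exact Subtype.ext e2
  refine ⟨R.image (fun x => ((x : ↥St) : ↥grigorchukGroup)) ∪ R.image (fun x => aG * ((x : ↥St) : ↥grigorchukGroup)), fun g => ?_⟩
  rcases mem_stabOne_or g.2 with ⟨hg, -⟩ | ⟨hg, -⟩
  · obtain ⟨x, hxR, hx⟩ := hR ⟨g, hg⟩
    obtain ⟨a, ha, b, hb, e⟩ := hAB _ hx
    exact ⟨(x : ↥grigorchukGroup), Finset.mem_union_left _ (Finset.mem_image_of_mem _ hxR), a, ha, b, hb, e⟩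
  · have hg' : g * aG ∈ St := hg
    obtain ⟨x, hxR, hx⟩ := hR ⟨g * aG, hg'⟩
    obtain ⟨a, ha, b, hb, e⟩ := hAB _ hx
    exact ⟨aG * (x : ↥grigorchukGroup), Finset.mem_union_right _ (Finset.mem_image_of_mem _ hxR), a, ha, b, hb, by
      rw [← mul_assoc]; exact e⟩

/-! ## §2 `Cay(𝔊; S)` has exactly one end, for every finite generating set `S` -/

/-- **THE CAYLEY GRAPHS OF THE FIRST GRIGORCHUK GROUP ARE ONE-ENDED**: for every finite generating set `S`, `Cay(𝔊; S)` has EXACTLY ONE END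
(Mathlib `SimpleGraph.end`) — the commuting pair `ristG 0`, `ristG 1` (p606245) in F-OE1's criterion.  (In print: amenable and not virtually cyclic ⟹ one
end, via Stallings; the tree's proof is the elementary commuting-pair argument.) [cite: MuchnikPak2001, Lemma 2 and Cor. 1] [cite: LyonsPeres2016, §7.6] -/
theorem cayley_gens_existsUnique_end (S : Finset ↥grigorchukGroup) (hS : Subgroup.closure (↑S : Set ↥grigorchukGroup) = ⊤) :
    ∃! e, e ∈ (mulCayley (↑S : Set ↥grigorchukGroup)).end :=
  OneEnd.end_existsUnique_of_commuting_subgroups S hS (ristG false) (ristG true) (ristG_fg false) (ristG_fg true)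
    (ristG_infinite false) (ristG_infinite true) (fun _ ha _ hb => commute_of_mem_ristG ha hb) (fun _ h0 h1 => eq_one_of_mem_ristG h0 h1)
    exists_ristG_coset_reps

/-- **`Cay(𝔊; a, b, c, d)` has EXACTLY ONE END.** [cite: MuchnikPak2001, Lemma 2 and Cor. 1] [cite: BenjaminiSchramm1996, Def. 1 (p. 75)] -/
theorem stdCay_existsUnique_end : ∃! e, e ∈ stdCay.end := cayley_gens_existsUnique_end _ closure_gens_finset

/-- Left multiplications act transitively on a right Cayley graph: `Aut(Cay(Γ; S))` is vertex-transitive in Mathlib's sense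
(`MulAction.IsPretransitive (G ≃g G) V`, the binder of `BenjaminiSchramm1996_question3`). [cite: BenjaminiSchramm1996, §2 (Cayley graphs are transitive)] -/
theorem isPretransitive_aut_mulCayley {Γ : Type} [Group Γ] (S : Finset Γ) :
    MulAction.IsPretransitive (mulCayley (↑S : Set Γ) ≃g mulCayley (↑S : Set Γ)) Γ :=
  ⟨fun x y => ⟨leftMulIso S (y * x⁻¹), show y * x⁻¹ * x = y by rw [inv_mul_cancel_right]⟩⟩

/-- **CONSISTENCY INSTANCE of Benjamini–Schramm's Question 3 on `Cay(𝔊; a, b, c, d)`**: ALL its hypotheses — connected, vertex-transitive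
(`MulAction.IsPretransitive (G ≃g G) V`), EXACTLY ONE END — AND its conclusion `p_u < 1` (kernel by amenability, p607347/p613200) hold.  An instance, NOT
evidence about the question (its content is the non-amenable case); `BenjaminiSchramm1996_question3` stays OPEN.
[cite: BenjaminiSchramm1996, Question 3 (p. 79), Def. 1 (p. 75)] [cite: LyonsPeres2016, Thm. 7.6] -/
theorem stdCay_question3_instance : stdCay.Connected ∧ MulAction.IsPretransitive (stdCay ≃g stdCay) ↥grigorchukGroup ∧
    (∃! e, e ∈ stdCay.end) ∧ uniquenessProb stdCay < 1 :=
  ⟨CayleyScaled.connected_mulCayley_of_closure _ closure_gens_finset, isPretransitive_aut_mulCayley _, stdCay_existsUnique_end,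
    uniquenessProb_cayley_lt_one⟩

/-- **CONSISTENCY INSTANCE of Lyons–Peres Conj. 7.27 on every `Cay(𝔊; S)`**: connected, quasi-transitive, EXACTLY ONE END, and `p_u < 1` (p613200) — all
kernel; the conjecture stays OPEN. [cite: LyonsPeres2016, §7.6 Conj. 7.27, Thm. 7.6] [cite: BenjaminiSchramm1996, Question 3 (p. 79)] -/
theorem cayley_gens_conj_7_27_instance (S : Finset ↥grigorchukGroup) (hS : Subgroup.closure (↑S : Set ↥grigorchukGroup) = ⊤) :
    (mulCayley (↑S : Set ↥grigorchukGroup)).Connected ∧ IsQuasiTransitive (mulCayley (↑S : Set ↥grigorchukGroup)) ∧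
      (∃! e, e ∈ (mulCayley (↑S : Set ↥grigorchukGroup)).end) ∧ uniquenessProb (mulCayley (↑S : Set ↥grigorchukGroup)) < 1 :=
  ⟨CayleyScaled.connected_mulCayley_of_closure S hS, CayleyScaled.isQuasiTransitive_mulCayley S, cayley_gens_existsUnique_end S hS,
    uniquenessProb_lt_one_gens S hS⟩

/-! ## §3 `Cay(𝔊 × ℤ; a, b, c, d, z)` has exactly one end -/

/-- **`Cay(𝔊 × ℤ; a, b, c, d, z)` has EXACTLY ONE END**: the commuting pair `𝔊 × 1 = ⟨a,b,c,d⟩` and `1 × ℤ = ⟨z⟩` (product the whole group, `F = {1}`) in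
F-OE1's criterion. [cite: LyonsPeres2016, §7.6] [cite: BenjaminiSchramm1996, Def. 1 (p. 75)] -/
theorem gzCay_existsUnique_end : ∃! e, e ∈ gzCay.end := by
  have h1 : ∀ x ∈ Subgroup.closure (↑({aP, bP, cP, dP} : Finset GZ) : Set GZ), x.2 = 1 := by
    intro x hx
    induction hx using Subgroup.closure_induction with
    | mem y hy =>
      simp only [Finset.coe_insert, Finset.coe_singleton, Set.mem_insert_iff, Set.mem_singleton_iff] at hy
      rcases hy with rfl | rfl | rfl | rfl <;> rfl
    | one => rfl
    | mul y z _ _ hy hz => rw [Prod.snd_mul, hy, hz, mul_one]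
    | inv y _ hy => rw [Prod.snd_inv, hy, inv_one]
  have h2 : ∀ x ∈ Subgroup.closure (↑({zP} : Finset GZ) : Set GZ), x.1 = 1 := by
    intro x hx
    induction hx using Subgroup.closure_induction with
    | mem y hy =>
      simp only [Finset.coe_singleton, Set.mem_singleton_iff] at hy
      rw [hy]; rfl
    | one => rfl
    | mul y z _ _ hy hz => rw [Prod.fst_mul, hy, hz, mul_one]
    | inv y _ hy => rw [Prod.fst_inv, hy, inv_one]
  have hG1 : ∀ g : ↥grigorchukGroup, ((g, 1) : GZ) ∈ Subgroup.closure (↑({aP, bP, cP, dP} : Finset GZ) : Set GZ) := by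
    intro g
    have hg : g ∈ Subgroup.closure ({aG, bG, cG, dG} : Set ↥grigorchukGroup) := by rw [closure_gens_eq_top]; trivial
    induction hg using Subgroup.closure_induction with
    | mem y hy =>
      refine Subgroup.subset_closure ?_
      simp only [Set.mem_insert_iff, Set.mem_singleton_iff] at hy
      simp only [Finset.coe_insert, Finset.coe_singleton, Set.mem_insert_iff, Set.mem_singleton_iff, aP, bP, cP, dP]
      rcases hy with rfl | rfl | rfl | rfl
      · exact Or.inl rfl
      · exact Or.inr (Or.inl rfl)
      · exact Or.inr (Or.inr (Or.inl rfl))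
      · exact Or.inr (Or.inr (Or.inr rfl))
    | one => exact Subgroup.one_mem _
    | mul y z _ _ hy hz => simpa only [Prod.mk_mul_mk, mul_one] using Subgroup.mul_mem _ hy hz
    | inv y _ hy => simpa only [Prod.inv_mk, inv_one] using Subgroup.inv_mem _ hy
  have hZ1 : ∀ m : Multiplicative ℤ, ((1, m) : GZ) ∈ Subgroup.closure (↑({zP} : Finset GZ) : Set GZ) := by
    intro m
    rw [Finset.coe_singleton, Subgroup.mem_closure_singleton]
    refine ⟨Multiplicative.toAdd m, ?_⟩
    change (MonoidHom.inr ↥grigorchukGroup (Multiplicative ℤ) (Multiplicative.ofAdd (1 : ℤ))) ^ Multiplicative.toAdd m = _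
    rw [← map_zpow, ← ofAdd_zsmul, smul_eq_mul, mul_one, ofAdd_toAdd]
    rfl
  refine OneEnd.end_existsUnique_of_commuting_subgroups gzGens closure_gzGens
    (Subgroup.closure (↑({aP, bP, cP, dP} : Finset GZ) : Set GZ)) (Subgroup.closure (↑({zP} : Finset GZ) : Set GZ)) ⟨_, rfl⟩ ⟨_, rfl⟩ ?_ ?_ ?_ ?_
    ⟨{1}, fun g => ⟨1, Finset.mem_singleton_self 1, (g.1, 1), hG1 g.1, (1, g.2), hZ1 g.2, Prod.ext (by simp) (by simp)⟩⟩
  · haveI : Infinite ↥grigorchukGroup := Set.infinite_coe_iff.2 grigorchukGroup_infinite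
    exact Set.infinite_of_injective_forall_mem (f := fun g : ↥grigorchukGroup => ((g, 1) : GZ)) (fun g g' h => (Prod.ext_iff.1 h).1) hG1
  · exact Set.infinite_of_injective_forall_mem (f := fun m : Multiplicative ℤ => ((1, m) : GZ)) (fun _ _ h => (Prod.ext_iff.1 h).2) hZ1
  · intro a ha b hb
    refine Prod.ext ?_ ?_
    · change a.1 * b.1 = b.1 * a.1
      rw [h2 b hb, mul_one, one_mul]
    · change a.2 * b.2 = b.2 * a.2
      rw [h1 a ha, mul_one, one_mul]
  · intro x hx1 hx2
    exact Prod.ext (h2 x hx2) (h1 x hx1)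

/-- **`p_u = p_c < 1` on `Cay(𝔊 × ℤ; a, b, c, d, z)`** (amenable quasi-transitive, p645243: Lyons–Peres 7.6; `p_c < 1` kernel). [cite: LyonsPeres2016, Thm. 7.6]
[cite: BenjaminiSchramm1996, Question 3 (p. 79)] -/
theorem gzCay_uniquenessProb_lt_one (x : GZ) : uniquenessProb gzCay = criticalProb gzCay x ∧ uniquenessProb gzCay < 1 :=
  ⟨uniquenessProb_eq_criticalProb_of_amenable _ gzCay_connected gzCay_isQuasiTransitive gzCay_isGraphAmenable x,
    uniquenessProb_lt_one_of_amenable _ gzCay_connected gzCay_isQuasiTransitive gzCay_isGraphAmenable x (gzCay_criticalProb_lt_one x)⟩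

/-- **CONSISTENCY INSTANCES of Benjamini–Schramm's Question 3 and Lyons–Peres Conj. 7.27 on `Cay(𝔊 × ℤ; a, b, c, d, z)`**: connected, vertex-transitive
and quasi-transitive, EXACTLY ONE END, and `p_u < 1` — all kernel; the questions stay OPEN. [cite: BenjaminiSchramm1996, Question 3 (p. 79)]
[cite: LyonsPeres2016, §7.6 Conj. 7.27, Thm. 7.6] -/
theorem gzCay_question3_instance : gzCay.Connected ∧ MulAction.IsPretransitive (gzCay ≃g gzCay) GZ ∧ IsQuasiTransitive gzCay ∧
    (∃! e, e ∈ gzCay.end) ∧ uniquenessProb gzCay < 1 :=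
  ⟨gzCay_connected, isPretransitive_aut_mulCayley _, gzCay_isQuasiTransitive, gzCay_existsUnique_end, (gzCay_uniquenessProb_lt_one 1).2⟩

end Grigorchuk

end Summit.CriticalPhenomena.PercolationContinuityZ3.Theorems.Transplant

end
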